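import Summits.FinalStateConjecture.FinalStateConjecture.Theorems.EIHFluxBalanceInertialRecessionStubFirstOrderShell
import Summits.FinalStateConjecture.FinalStateConjecture.Theorems.EIHFluxBalanceInertialRecessionStubFirstOrderAnsatzJet
import Summits.FinalStateConjecture.FinalStateConjecture.Theorems.EIHFluxBalanceInertialRecessionStubSlaving12JetCompact
import Summits.FinalStateConjecture.FinalStateConjecture.Theorems.EIHFluxBalanceInertialRecessionBoostedDecay
import Literature.Geometry.Lorentzian.CoordCurvature

/-!
# Route EIHFluxBalance — `InertialRecession` (E′), skeleton r13, stub `stub_firstOrderSlaving` (D),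
# part 8: the frozen (inertially continued) background near a hole at late times

Helper file for the crux `stmt-FinalStateConjecture-17403` (E′), stub (D). The background of the
linear absorption step is the ansatz FROZEN at lab time `t`,
`G_t = η + Σⱼ (boostedKerrBilin (Λⱼ(t)) (t, ξⱼ(t)) Mⱼ aⱼ − η)`, together with the first-order
modulated fields `G_t + (x⁰ − t) Σ_{j ∈ S} Vⱼ` (`Vⱼ` the lab first-variation fields of the holes).

* `firstOrder_isMetricOn_of` — smooth symmetric fields are metric components on
  `U ∩ {invertible}`; smoothness and symmetry of `G_t` and of the `Vⱼ`;
* `firstOrder_frozen_far_jets` — eventually, near hole `i`, the OTHER frozen summands are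
  `C²`-small (`exists_norm_iteratedFDeriv_ksPert_frame_le'` with constant frames, receding centres);
* `firstOrder_frozen_far_variation` — eventually, near hole `i`, the other holes' variation fields
  and their derivatives are `≤ δ ·` (reduced rate) (`firstOrder_far_variation_red`).

Elementary; no definitions, no named facts.
-/

set_option linter.dupNamespace false
set_option maxSynthPendingDepth 3

noncomputable section

open scoped Topology BigOperators
open Filter Set Function Metric Literature.Geometry.Lorentzian Literature.Geometry.Lorentzian.MetricCoord
  Summit.FinalStateConjecture.FinalStateConjecture.Theorems

namespace Summit.FinalStateConjecture.FinalStateConjecture.Theorems.SublinearIsFree.Slaving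

/-! ### Metric components from smoothness and symmetry -/

section Generic

/-- Invertible forms form an open set (the range of `E ≃L E* → E →L E*` is open). [folklore] -/
theorem firstOrder_isOpen_isInvertible :
    IsOpen {B : E4 →L[ℝ] E4 →L[ℝ] ℝ | B.IsInvertible} := by
  have h : {B : E4 →L[ℝ] E4 →L[ℝ] ℝ | B.IsInvertible} =
      Set.range (ContinuousLinearEquiv.toContinuousLinearMap :
        (E4 ≃L[ℝ] (E4 →L[ℝ] ℝ)) → (E4 →L[ℝ] E4 →L[ℝ] ℝ)) := by
    ext B
    simp only [Set.mem_setOf_eq, Set.mem_range, ContinuousLinearMap.IsInvertible]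
  rw [h]
  exact ContinuousLinearEquiv.isOpen

/-- **Smooth symmetric fields are metric components where they are invertible**: if `G` is `C^∞` at
every point of an open `U` and everywhere symmetric, then `G` is a field of metric components
(`MetricCoord.IsMetricOn`) on the open set `U ∩ {z | G z invertible}`. [cite: ONeill1983, Ch. 3, Def. 3.1] -/
theorem firstOrder_isMetricOn_of {G : E4 → E4 →L[ℝ] E4 →L[ℝ] ℝ} {U : Set E4} (hU : IsOpen U)
    (hG : ∀ z ∈ U, ContDiffAt ℝ ((⊤ : ℕ∞) : WithTop ℕ∞) G z) (hs : ∀ z v w, G z v w = G z w v) :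
    MetricCoord.IsMetricOn G (U ∩ {z | (G z).IsInvertible}) where
  isOpen := by
    have hc : ContinuousOn G U := fun z hz ↦ (hG z hz).continuousAt.continuousWithinAt
    exact hc.isOpen_inter_preimage hU firstOrder_isOpen_isInvertible
  contDiffOn := fun z hz ↦ (hG z hz.1).contDiffWithinAt
  symm := fun z _ v w ↦ hs z v w
  isInvertible := fun z hz ↦ hz.2

/-- Restricting metric components to an open subset. [folklore] -/
theorem firstOrder_isMetricOn_inter {G : E4 → E4 →L[ℝ] E4 →L[ℝ] ℝ} {V W : Set E4}
    (h : MetricCoord.IsMetricOn G V) (hW : IsOpen W) : MetricCoord.IsMetricOn G (V ∩ W) where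
  isOpen := h.isOpen.inter hW
  contDiffOn := h.contDiffOn.mono Set.inter_subset_left
  symm := fun z hz v w ↦ h.symm z hz.1 v w
  isInvertible := fun z hz ↦ h.isInvertible z hz.1

/-- Coercive forms are invertible. [folklore] -/
theorem firstOrder_isInvertible_of_coercive {B : E4 →L[ℝ] E4 →L[ℝ] ℝ} {μ : ℝ} (hμ : 0 < μ)
    (h : ∀ v : E4, μ * ‖v‖ ≤ ‖B v‖) : B.IsInvertible := by
  refine MetricCoord.isInvertible_of_nondegenerate fun v hv ↦ ?_
  have h0 : B v = 0 := ContinuousLinearMap.ext fun w ↦ hv w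
  have h1 := h v
  rw [h0, norm_zero] at h1
  exact norm_le_zero_iff.1 (by nlinarith [norm_nonneg v])

/-- **The derivative of a field of symmetric forms is symmetric**: for `g = g_{M,a}`,
`∂_u g(v, w) = ∂_u g(w, v)`. [folklore] -/
theorem firstOrder_fderiv_kerr_symm (M a : ℝ) (y u v w : E4) :
    fderiv ℝ (Kerr.bilin M a) y u v w = fderiv ℝ (Kerr.bilin M a) y u w v := by
  set fl : (E4 →L[ℝ] E4 →L[ℝ] ℝ) ≃L[ℝ] (E4 →L[ℝ] E4 →L[ℝ] ℝ) :=
    (ContinuousLinearMap.flipₗᵢ ℝ E4 E4 ℝ).toContinuousLinearEquiv with hfl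
  have hK : Kerr.bilin M a = fl ∘ Kerr.bilin M a := by
    funext y'
    ext v' w'
    show Kerr.bilin M a y' v' w' = (Kerr.bilin M a y').flip v' w'
    rw [ContinuousLinearMap.flip_apply]
    exact Kerr.bilin_symm M a y' v' w'
  conv_rhs => rw [hK, fl.comp_fderiv]
  rfl

end Generic

/-! ### The lab first-variation field: smoothness and symmetry -/

section Variation

variable (L : lorentzGroup) (A : E4 →L[ℝ] E4) (d c : E4) (M a : ℝ)

-- the algebraic and the operator-norm instance paths on `E4 →L[ℝ] E4 →L[ℝ] ℝ` unify slowly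
set_option synthInstance.maxHeartbeats 200000 in
/-- **The lab first-variation field is smooth wherever the rest-frame radius is positive.**
[cite: KerrSchild1965, §3] -/
theorem firstOrder_contDiffAt_variation {z : E4} (hz : 0 < Kerr.radius a (poincareInv L c z)) :
    ContDiffAt ℝ ((⊤ : ℕ∞) : WithTop ℕ∞) (fun z ↦
      (fderiv ℝ (Kerr.bilin M a) (poincareInv L c z) (A (poincareInv L c z) + d)).bilinearComp
          (((L : E4 ≃L[ℝ] E4).symm : E4 →L[ℝ] E4)) (((L : E4 ≃L[ℝ] E4).symm : E4 →L[ℝ] E4)) +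
        (Kerr.bilin M a (poincareInv L c z)).bilinearComp
          (A.comp (((L : E4 ≃L[ℝ] E4).symm : E4 →L[ℝ] E4))) (((L : E4 ≃L[ℝ] E4).symm : E4 →L[ℝ] E4)) +
        (Kerr.bilin M a (poincareInv L c z)).bilinearComp
          (((L : E4 ≃L[ℝ] E4).symm : E4 →L[ℝ] E4)) (A.comp (((L : E4 ≃L[ℝ] E4).symm : E4 →L[ℝ] E4))))
      z := by
  set S : E4 →L[ℝ] E4 := (((L : E4 ≃L[ℝ] E4).symm : E4 →L[ℝ] E4)) with hS
  set K := Kerr.bilin M a with hK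
  have hP : ContDiff ℝ ((⊤ : ℕ∞) : WithTop ℕ∞) (poincareInv L c) := contDiff_poincareInv L c
  have hK0 : ContDiffAt ℝ ((⊤ : ℕ∞) : WithTop ℕ∞) (fun z ↦ K (poincareInv L c z)) z :=
    ContDiffAt.comp (g := K) (f := poincareInv L c) z (Kerr.contDiffAt_bilin M a hz) hP.contDiffAt
  have hK1 : ContDiffAt ℝ ((⊤ : ℕ∞) : WithTop ℕ∞) (fun z ↦ fderiv ℝ K (poincareInv L c z)) z := by
    have h := (Kerr.contDiffAt_bilin M a hz (n := ((⊤ : ℕ∞) : WithTop ℕ∞))).fderiv_right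
      (m := ((⊤ : ℕ∞) : WithTop ℕ∞)) (by simp)
    exact ContDiffAt.comp (g := fderiv ℝ K) (f := poincareInv L c) z h hP.contDiffAt
  have hu : ContDiffAt ℝ ((⊤ : ℕ∞) : WithTop ℕ∞) (fun z ↦ A (poincareInv L c z) + d) z :=
    (A.contDiff.contDiffAt.comp z hP.contDiffAt).add contDiffAt_const
  have h1 : ContDiffAt ℝ ((⊤ : ℕ∞) : WithTop ℕ∞)
      (fun z ↦ fderiv ℝ K (poincareInv L c z) (A (poincareInv L c z) + d)) z := hK1.clm_apply hu
  have hc : ∀ (A' S' : E4 →L[ℝ] E4) {T : E4 → E4 →L[ℝ] E4 →L[ℝ] ℝ},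
      ContDiffAt ℝ ((⊤ : ℕ∞) : WithTop ℕ∞) T z →
      ContDiffAt ℝ ((⊤ : ℕ∞) : WithTop ℕ∞) (fun z ↦ (T z).bilinearComp A' S') z := by
    intro A' S' T hT
    have e : (fun z ↦ (T z).bilinearComp A' S') =
        fun z ↦ ((ContinuousLinearMap.compL ℝ E4 E4 ℝ).flip S').comp ((T z).comp A') :=
      funext fun z ↦ by ext v w; rfl
    rw [e]
    exact contDiffAt_const.clm_comp (hT.clm_comp contDiffAt_const)
  exact ((hc S S h1).add (hc (A.comp S) S hK0)).add (hc S (A.comp S) hK0)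

/-- **The lab first-variation field is symmetric.** [folklore] -/
theorem firstOrder_variation_symm (z v w : E4) :
    ((fderiv ℝ (Kerr.bilin M a) (poincareInv L c z) (A (poincareInv L c z) + d)).bilinearComp
          (((L : E4 ≃L[ℝ] E4).symm : E4 →L[ℝ] E4)) (((L : E4 ≃L[ℝ] E4).symm : E4 →L[ℝ] E4)) +
        (Kerr.bilin M a (poincareInv L c z)).bilinearComp
          (A.comp (((L : E4 ≃L[ℝ] E4).symm : E4 →L[ℝ] E4))) (((L : E4 ≃L[ℝ] E4).symm : E4 →L[ℝ] E4)) +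
        (Kerr.bilin M a (poincareInv L c z)).bilinearComp
          (((L : E4 ≃L[ℝ] E4).symm : E4 →L[ℝ] E4)) (A.comp (((L : E4 ≃L[ℝ] E4).symm : E4 →L[ℝ] E4)))) v w =
    ((fderiv ℝ (Kerr.bilin M a) (poincareInv L c z) (A (poincareInv L c z) + d)).bilinearComp
          (((L : E4 ≃L[ℝ] E4).symm : E4 →L[ℝ] E4)) (((L : E4 ≃L[ℝ] E4).symm : E4 →L[ℝ] E4)) +
        (Kerr.bilin M a (poincareInv L c z)).bilinearComp
          (A.comp (((L : E4 ≃L[ℝ] E4).symm : E4 →L[ℝ] E4))) (((L : E4 ≃L[ℝ] E4).symm : E4 →L[ℝ] E4)) +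
        (Kerr.bilin M a (poincareInv L c z)).bilinearComp
          (((L : E4 ≃L[ℝ] E4).symm : E4 →L[ℝ] E4)) (A.comp (((L : E4 ≃L[ℝ] E4).symm : E4 →L[ℝ] E4)))) w v := by
  simp only [add_apply, ContinuousLinearMap.bilinearComp_apply, ContinuousLinearMap.comp_apply]
  rw [firstOrder_fderiv_kerr_symm M a _ _ _ ((((L : E4 ≃L[ℝ] E4).symm : E4 →L[ℝ] E4)) v),
    Kerr.bilin_symm M a _ (A _) ((((L : E4 ≃L[ℝ] E4).symm : E4 →L[ℝ] E4)) v),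
    Kerr.bilin_symm M a _ ((((L : E4 ≃L[ℝ] E4).symm : E4 →L[ℝ] E4)) w) (A _)]
  ring

end Variation

/-! ### The frozen ansatz: domain, smoothness, symmetry -/

section Frozen

variable {N : ℕ} {M a : Fin N → ℝ} {Λ : Fin N → ℝ → lorentzGroup} {ξ : Fin N → ℝ → E3}

/-- The set where all rest-frame radii frozen at `t` are positive is open. [folklore] -/
theorem firstOrder_isOpen_frozenDomain (a : Fin N → ℝ) (Λ : Fin N → ℝ → lorentzGroup)
    (ξ : Fin N → ℝ → E3) (t : ℝ) :
    IsOpen {z : E4 | ∀ j, 0 < Kerr.radius (a j) (poincareInv (Λ j t) (E4.ofTimeSpace t (ξ j t)) z)} := by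
  rw [show {z : E4 | ∀ j, 0 < Kerr.radius (a j) (poincareInv (Λ j t) (E4.ofTimeSpace t (ξ j t)) z)} =
    ⋂ j, {z : E4 | 0 < Kerr.radius (a j) (poincareInv (Λ j t) (E4.ofTimeSpace t (ξ j t)) z)} by
    ext z; simp]
  exact isOpen_iInter_of_finite fun j ↦
    isOpen_lt continuous_const ((Kerr.continuous_radius _).comp (continuous_poincareInv _ _))

/-- The set where all painted (moving) radii are positive is open. [folklore] -/
theorem firstOrder_isOpen_movingDomain (a : Fin N → ℝ)
    (hsm : ∀ i, ContDiff ℝ ((⊤ : ℕ∞) : WithTop ℕ∞) (ξ i) ∧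
      ContDiff ℝ ((⊤ : ℕ∞) : WithTop ℕ∞) (fun t ↦ ((Λ i t : E4 ≃L[ℝ] E4) : E4 →L[ℝ] E4))) :
    IsOpen {z : E4 | ∀ j, 0 < Kerr.radius (a j)
      (poincareInv (Λ j (z 0)) (E4.ofTimeSpace (z 0) (ξ j (z 0))) z)} := by
  have hcont : ∀ j, Continuous (fun z : E4 ↦
      poincareInv (Λ j (z 0)) (E4.ofTimeSpace (z 0) (ξ j (z 0))) z) := by
    intro j
    have h0 : ContDiff ℝ ((⊤ : ℕ∞) : WithTop ℕ∞) (fun y : E4 ↦ y 0) :=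
      (EuclideanSpace.proj (0 : Fin 4) (𝕜 := ℝ)).contDiff
    have hA : ContDiff ℝ ((⊤ : ℕ∞) : WithTop ℕ∞)
        (fun y : E4 ↦ (((Λ j (y 0) : E4 ≃L[ℝ] E4).symm : E4 ≃L[ℝ] E4) : E4 →L[ℝ] E4)) :=
      (contDiff_lorentz_symm (hsm j).2).comp h0
    have hP : ContDiff ℝ ((⊤ : ℕ∞) : WithTop ℕ∞)
        (fun y : E4 ↦ poincareInv (Λ j (y 0)) (E4.ofTimeSpace (y 0) (ξ j (y 0))) y) := by
      show ContDiff ℝ _ (fun y : E4 ↦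
        ((Λ j (y 0) : E4 ≃L[ℝ] E4).symm) (y - E4.ofTimeSpace (y 0) (ξ j (y 0))))
      exact hA.clm_apply (contDiff_id.sub (contDiff_centreEvent (hsm j).1))
    exact hP.continuous
  rw [show {z : E4 | ∀ j, 0 < Kerr.radius (a j)
      (poincareInv (Λ j (z 0)) (E4.ofTimeSpace (z 0) (ξ j (z 0))) z)} =
    ⋂ j, {z : E4 | 0 < Kerr.radius (a j)
      (poincareInv (Λ j (z 0)) (E4.ofTimeSpace (z 0) (ξ j (z 0))) z)} by ext z; simp]
  exact isOpen_iInter_of_finite fun j ↦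
    isOpen_lt continuous_const ((Kerr.continuous_radius _).comp (hcont j))

/-- **The frozen ansatz is smooth where all its rest-frame radii are positive.** [cite: KerrSchild1965, §3] -/
theorem firstOrder_contDiffAt_frozen (M : Fin N → ℝ) {t : ℝ} {z : E4}
    (hz : ∀ j, 0 < Kerr.radius (a j) (poincareInv (Λ j t) (E4.ofTimeSpace t (ξ j t)) z)) :
    ContDiffAt ℝ ((⊤ : ℕ∞) : WithTop ℕ∞) (fun z : E4 ↦ Minkowski.bilin +
      ∑ j, (boostedKerrBilin (Λ j t) (E4.ofTimeSpace t (ξ j t)) (M j) (a j) z - Minkowski.bilin)) z :=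
  contDiffAt_const.add (ContDiffAt.sum fun j _ ↦
    (contDiffAt_boostedKerrBilin (Λ j t) _ (M j) (a j) (hz j)).sub contDiffAt_const)

/-- The frozen ansatz is symmetric. [folklore] -/
theorem firstOrder_frozen_symm (M a : Fin N → ℝ) (Λ : Fin N → ℝ → lorentzGroup)
    (ξ : Fin N → ℝ → E3) (t : ℝ) (z v w : E4) :
    (Minkowski.bilin + ∑ j, (boostedKerrBilin (Λ j t) (E4.ofTimeSpace t (ξ j t)) (M j) (a j) z -
      Minkowski.bilin)) v w =
    (Minkowski.bilin + ∑ j, (boostedKerrBilin (Λ j t) (E4.ofTimeSpace t (ξ j t)) (M j) (a j) z -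
      Minkowski.bilin)) w v := by
  simp only [add_apply, sum_apply, sub_apply, boostedKerrBilin_apply,
    Minkowski.bilin_symm v w, Kerr.bilin_symm _ _ _ _ ((((Λ _ t : E4 ≃L[ℝ] E4).symm) w))]

/-! ### Eventually: the other holes are far in `C²`, and their variation fields are small -/

-- the algebraic and the operator-norm instance paths on `E4 →L[ℝ] E4 →L[ℝ] ℝ` unify slowly
set_option synthInstance.maxHeartbeats 200000 in
set_option maxHeartbeats 800000 in
/-- **Eventually the other frozen summands are `C²`-small near hole `i`.** With Lorentz factors
`≤ γ` and separating centres: for every `R` and `δ > 0`, eventually in `t`, at every lab event `x`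
of the slice `{x⁰ = t}` with `‖x̲ − ξᵢ(t)‖ ≤ R`, every other summand frozen at `t` satisfies
`‖Dᵏ(boostedKerrBilin (Λⱼ(t)) (t, ξⱼ(t)) Mⱼ aⱼ − η)(x)‖ ≤ δ` for `k ≤ 2`
(`exists_norm_iteratedFDeriv_ksPert_frame_le'` with constant frame and centre; Kerr–Schild 1965,
§3). [cite: KerrSchild1965, §3] -/
theorem firstOrder_frozen_far_jets {γ : ℝ}
    (hγ : ∀ i t, |((Λ i t : E4 ≃L[ℝ] E4) (E4.basisVector 0)) 0| ≤ γ)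
    (hsep : ∀ i j, i ≠ j → Tendsto (fun t ↦ ‖ξ i t - ξ j t‖) atTop atTop)
    (i : Fin N) (R : ℝ) {δ : ℝ} (hδ : 0 < δ) :
    ∀ᶠ t in atTop, ∀ x : E4, x 0 = t → ‖E4.spatial x - ξ i t‖ ≤ R → ∀ j, j ≠ i → ∀ k ≤ 2,
      ‖iteratedFDeriv ℝ k (fun z : E4 ↦ boostedKerrBilin (Λ j t) (E4.ofTimeSpace t (ξ j t)) (M j) (a j) z -
        Minkowski.bilin) x‖ ≤ δ := by
  set Γ : ℝ := 1 + 3 * |γ| with hΓ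
  have hΓ1 : 1 ≤ Γ := by rw [hΓ]; linarith [abs_nonneg γ]
  obtain ⟨C₀, hC₀, h0⟩ := exists_norm_iteratedFDeriv_ksPert_frame_le' 0 hΓ1
  obtain ⟨C₁, hC₁, h1⟩ := exists_norm_iteratedFDeriv_ksPert_frame_le' 1 hΓ1
  obtain ⟨C₂, hC₂, h2⟩ := exists_norm_iteratedFDeriv_ksPert_frame_le' 2 hΓ1
  set C : ℝ := C₀ + C₁ + C₂ with hC
  have hCk : C₀ ≤ C ∧ C₁ ≤ C ∧ C₂ ≤ C := ⟨by rw [hC]; linarith, by rw [hC]; linarith, by rw [hC]; linarith⟩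
  -- eventually the other centres are far
  have E1 : ∀ j, ∀ᶠ t in atTop, j ≠ i →
      R + (max 1 (2 * |a j|) + (|M j| * C / δ + 1)) ≤ ‖ξ i t - ξ j t‖ := by
    intro j
    by_cases hij : j = i
    · exact Eventually.of_forall fun t h ↦ (h hij).elim
    · exact ((hsep i j (Ne.symm hij)).eventually_ge_atTop _).mono fun t ht _ ↦ ht
  filter_upwards [eventually_all.2 E1] with t ht x hx0 hxR j hji k hk
  set S : E4 →L[ℝ] E4 := (((Λ j t : E4 ≃L[ℝ] E4).symm : E4 →L[ℝ] E4)) with hS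
  obtain ⟨hxc0, hxcn⟩ := sub_ofTimeSpace_apply_zero hx0 (ξ j t)
  have hfar := ht j hji
  have htri : ‖ξ i t - ξ j t‖ ≤ ‖E4.spatial x - ξ i t‖ + ‖E4.spatial x - ξ j t‖ := by
    calc ‖ξ i t - ξ j t‖ = ‖(E4.spatial x - ξ j t) - (E4.spatial x - ξ i t)‖ := by congr 1; abel
      _ ≤ _ := norm_sub_le _ _
      _ = _ := add_comm _ _
  have hdist : max 1 (2 * |a j|) + (|M j| * C / δ + 1) ≤ ‖x - E4.ofTimeSpace t (ξ j t)‖ := by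
    rw [hxcn]; linarith
  have hMC : 0 ≤ |M j| * C / δ + 1 := by positivity
  have hd1 : max 1 (2 * |a j|) ≤ ‖x - E4.ofTimeSpace t (ξ j t)‖ := by linarith
  have hd0 : 0 < ‖x - E4.ofTimeSpace t (ξ j t)‖ :=
    lt_of_lt_of_le (lt_of_lt_of_le one_pos (le_max_left _ _)) hd1
  set d : ℝ := ‖x - E4.ofTimeSpace t (ξ j t)‖ with hd
  set c : E4 := E4.ofTimeSpace t (ξ j t) with hc
  have hSn : ‖S‖ ≤ Γ := by
    refine (norm_lorentz_symm_le' (Λ j t)).trans ?_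
    rw [hΓ]; linarith [(hγ j t).trans (le_abs_self γ)]
  -- the constant frame and centre
  have hΘ : ContDiff ℝ k (fun _ : ℝ ↦ S) := contDiff_const
  have hcc : ContDiff ℝ k (fun _ : ℝ ↦ c) := contDiff_const
  have hΘb : ∀ k' ≤ k, ‖iteratedDeriv k' (fun _ : ℝ ↦ S) (x 0)‖ ≤ Γ := by
    intro k' _
    rw [iteratedDeriv_const]
    by_cases hk0 : k' = 0
    · simpa [hk0] using hSn
    · simp only [hk0, if_false, norm_zero]; positivity
  have hcb : ∀ k', 1 ≤ k' → k' ≤ k → ‖iteratedDeriv k' (fun _ : ℝ ↦ c) (x 0)‖ ≤ Γ := by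
    intro k' hk1 _
    rw [iteratedDeriv_const]
    have hk0 : k' ≠ 0 := by omega
    simp only [hk0, if_false, norm_zero]; positivity
  have hsp : d ≤ E4.spatialNorm (S (x - c)) := by
    have h := norm_le_spatialNorm_lorentz_apply (Λ j t)⁻¹ hxc0
    rwa [coe_lorentz_inv] at h
  -- the function
  have hfun : (fun y : E4 ↦ (Kerr.bilin (M j) (a j) ((fun _ : ℝ ↦ S) (y 0) (y - (fun _ : ℝ ↦ c) (y 0))) -
      Minkowski.bilin).bilinearComp ((fun _ : ℝ ↦ S) (y 0)) ((fun _ : ℝ ↦ S) (y 0))) =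
      fun z : E4 ↦ boostedKerrBilin (Λ j t) (E4.ofTimeSpace t (ξ j t)) (M j) (a j) z -
        Minkowski.bilin := by
    have hη : ∀ v w : E4, Minkowski.bilin ((Λ j t : E4 ≃L[ℝ] E4).symm v) ((Λ j t : E4 ≃L[ℝ] E4).symm w) =
        Minkowski.bilin v w := fun v w ↦ (lorentzGroup.inv_mem (Λ j t).2) v w
    funext y
    ext v w
    simp only [ContinuousLinearMap.bilinearComp_apply, sub_apply, boostedKerrBilin_apply, hS, hc,
      ContinuousLinearEquiv.coe_coe, hη]
    rfl
  have key : ∀ {Ck : ℝ}, Ck ≤ C →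
      ‖iteratedFDeriv ℝ k (fun y : E4 ↦ (Kerr.bilin (M j) (a j) ((fun _ : ℝ ↦ S) (y 0)
        (y - (fun _ : ℝ ↦ c) (y 0))) - Minkowski.bilin).bilinearComp ((fun _ : ℝ ↦ S) (y 0))
        ((fun _ : ℝ ↦ S) (y 0))) x‖ ≤ |M j| * Ck / d → ‖iteratedFDeriv ℝ k (fun z : E4 ↦
        boostedKerrBilin (Λ j t) (E4.ofTimeSpace t (ξ j t)) (M j) (a j) z - Minkowski.bilin) x‖ ≤ δ := by
    intro Ck hCkC hb
    rw [hfun] at hb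
    refine hb.trans ?_
    have h3 : |M j| * C / δ + 1 ≤ d := by
      have : 0 ≤ max 1 (2 * |a j|) := zero_le_one.trans (le_max_left _ _)
      linarith
    have h4 : |M j| * C ≤ δ * d := by
      have := (div_le_iff₀ hδ).1 (by linarith : |M j| * C / δ ≤ d)
      linarith [mul_comm d δ]
    have h5 : |M j| * Ck ≤ |M j| * C := mul_le_mul_of_nonneg_left hCkC (abs_nonneg _)
    rw [div_le_iff₀ hd0]
    linarith
  interval_cases k
  · exact key hCk.1 (h0 (M j) (a j) (fun _ : ℝ ↦ S) (fun _ : ℝ ↦ c) x d hΘ hcc hΘb hcb hd1 le_rfl hsp)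
  · exact key hCk.2.1 (h1 (M j) (a j) (fun _ : ℝ ↦ S) (fun _ : ℝ ↦ c) x d hΘ hcc hΘb hcb hd1 le_rfl hsp)
  · exact key hCk.2.2 (h2 (M j) (a j) (fun _ : ℝ ↦ S) (fun _ : ℝ ↦ c) x d hΘ hcc hΘb hcb hd1 le_rfl hsp)

-- the algebraic and the operator-norm instance paths on `E4 →L[ℝ] E4 →L[ℝ] ℝ` unify slowly
set_option synthInstance.maxHeartbeats 200000 in
set_option maxHeartbeats 800000 in
/-- **Eventually the other holes' first-variation fields are small near hole `i`, relative to their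
reduced rates.** With Lorentz factors `≤ γ`, smooth moduli and separating centres: for every `R` and
`δ > 0`, eventually in `t`, at every lab event `x` of the slice `{x⁰ = t}` with `‖x̲ − ξᵢ(t)‖ ≤ R`
and every `j ≠ i`, the lab first-variation field `Vⱼ` of hole `j` at time `t` (body rates
`A = (d/ds Λⱼ⁻¹) ∘ Λⱼ(t)`, `d = −Λⱼ(t)⁻¹ċⱼ(t)`) satisfies
`‖Vⱼ(x)‖ + ‖DVⱼ(x)‖ ≤ δ (‖A e₀‖ + ‖d~‖ + ‖aⱼ · A e₃‖)` (`firstOrder_far_variation_red`).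
[cite: KerrSchild1965, §3] -/
theorem firstOrder_frozen_far_variation {γ : ℝ}
    (hγ : ∀ i t, |((Λ i t : E4 ≃L[ℝ] E4) (E4.basisVector 0)) 0| ≤ γ)
    (hsm : ∀ i, ContDiff ℝ ((⊤ : ℕ∞) : WithTop ℕ∞) (ξ i) ∧
      ContDiff ℝ ((⊤ : ℕ∞) : WithTop ℕ∞) (fun t ↦ ((Λ i t : E4 ≃L[ℝ] E4) : E4 →L[ℝ] E4)))
    (hsep : ∀ i j, i ≠ j → Tendsto (fun t ↦ ‖ξ i t - ξ j t‖) atTop atTop)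
    (i : Fin N) (R : ℝ) {δ : ℝ} (hδ : 0 < δ) :
    ∀ᶠ t in atTop, ∀ x : E4, x 0 = t → ‖E4.spatial x - ξ i t‖ ≤ R → ∀ j, j ≠ i →
      ‖(fderiv ℝ (Kerr.bilin (M j) (a j)) (poincareInv (Λ j t) (E4.ofTimeSpace t (ξ j t)) x) (((deriv (fun s ↦ (((Λ j s : E4 ≃L[ℝ] E4).symm : E4 →L[ℝ] E4))) t).comp ((Λ j t : E4 ≃L[ℝ] E4) : E4 →L[ℝ] E4)) (poincareInv (Λ j t) (E4.ofTimeSpace t (ξ j t)) x) + (-((((Λ j t : E4 ≃L[ℝ] E4).symm : E4 →L[ℝ] E4)) (deriv (fun s ↦ E4.ofTimeSpace s (ξ j s)) t))))).bilinearComp (((Λ j t : E4 ≃L[ℝ] E4).symm : E4 →L[ℝ] E4)) (((Λ j t : E4 ≃L[ℝ] E4).symm : E4 →L[ℝ] E4)) + (Kerr.bilin (M j) (a j) (poincareInv (Λ j t) (E4.ofTimeSpace t (ξ j t)) x)).bilinearComp (((deriv (fun s ↦ (((Λ j s : E4 ≃L[ℝ] E4).symm : E4 →L[ℝ] E4)))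 t).comp ((Λ j t : E4 ≃L[ℝ] E4) : E4 →L[ℝ] E4)).comp (((Λ j t : E4 ≃L[ℝ] E4).symm : E4 →L[ℝ] E4))) (((Λ j t : E4 ≃L[ℝ] E4).symm : E4 →L[ℝ] E4)) + (Kerr.bilin (M j) (a j) (poincareInv (Λ j t) (E4.ofTimeSpace t (ξ j t)) x)).bilinearComp (((Λ j t : E4 ≃L[ℝ] E4).symm : E4 →L[ℝ] E4)) (((deriv (fun s ↦ (((Λ j s : E4 ≃L[ℝ] E4).symm : E4 →L[ℝ] E4))) t).comp ((Λ j t : E4 ≃L[ℝ] E4) : E4 →L[ℝ] E4)).comp (((Λ j t : E4 ≃L[ℝ] E4).symm : E4 →L[ℝ] E4)))‖ +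
      ‖fderiv ℝ (fun z : E4 ↦ (fderiv ℝ (Kerr.bilin (M j) (a j)) (poincareInv (Λ j t) (E4.ofTimeSpace t (ξ j t)) z) (((deriv (fun s ↦ (((Λ j s : E4 ≃L[ℝ] E4).symm : E4 →L[ℝ] E4))) t).comp ((Λ j t : E4 ≃L[ℝ] E4) : E4 →L[ℝ] E4)) (poincareInv (Λ j t) (E4.ofTimeSpace t (ξ j t)) z) + (-((((Λ j t : E4 ≃L[ℝ] E4).symm : E4 →L[ℝ] E4)) (deriv (fun s ↦ E4.ofTimeSpace s (ξ j s)) t))))).bilinearComp (((Λ j t : E4 ≃L[ℝ] E4).symm : E4 →L[ℝ] E4)) (((Λ j t : E4 ≃L[ℝ] E4).symm : E4 →L[ℝ] E4)) + (Kerr.bilin (M j) (a j) (poincareInv (Λ j t) (E4.ofTimeSpace t (ξ j t)) z)).bilinearComp (((deriv (fun s ↦ (((Λ j s : E4 ≃L[ℝ] E4).symm : E4 →L[ℝ] E4))) t).comp ((Λ j t : E4 ≃L[ℝ] E4) : E4 →L[ℝ] E4)).comp (((Λ j t : E4 ≃L[ℝ] E4).symm : E4 →L[ℝ] E4))) (((Λ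 j t : E4 ≃L[ℝ] E4).symm : E4 →L[ℝ] E4)) + (Kerr.bilin (M j) (a j) (poincareInv (Λ j t) (E4.ofTimeSpace t (ξ j t)) z)).bilinearComp (((Λ j t : E4 ≃L[ℝ] E4).symm : E4 →L[ℝ] E4)) (((deriv (fun s ↦ (((Λ j s : E4 ≃L[ℝ] E4).symm : E4 →L[ℝ] E4))) t).comp ((Λ j t : E4 ≃L[ℝ] E4) : E4 →L[ℝ] E4)).comp (((Λ j t : E4 ≃L[ℝ] E4).symm : E4 →L[ℝ] E4)))) x‖ ≤
        δ * (‖((deriv (fun s ↦ (((Λ j s : E4 ≃L[ℝ] E4).symm : E4 →L[ℝ] E4))) t).comp ((Λ j t : E4 ≃L[ℝ] E4) : E4 →L[ℝ] E4)) (E4.basisVector 0)‖ + ‖E4.spatial (-((((Λ j t : E4 ≃L[ℝ] E4).symm : E4 →L[ℝ] E4)) (deriv (fun s ↦ E4.ofTimeSpace s (ξ j s)) t)))‖ + ‖(a j) • ((deriv (fun s ↦ (((Λ j s : E4 ≃L[ℝ] E4).symm : E4 →L[ℝ] E4))) t).comp ((Λ j t : E4 ≃L[ℝ] E4) : E4 →L[ℝ]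 E4)) (E4.basisVector 3)‖) := by
  have hC : ∀ j, ∃ C : ℝ, 0 ≤ C ∧ _ := fun j ↦ firstOrder_far_variation_red (M j) (a j) γ
  choose C hC0 hCfar using hC
  have E1 : ∀ j, ∀ᶠ t in atTop, j ≠ i →
      R + ((max 1 (2 * |a j|) + |a j|) + (C j / δ + 1)) ≤ ‖ξ i t - ξ j t‖ := by
    intro j
    by_cases hij : j = i
    · exact Eventually.of_forall fun t h ↦ (h hij).elim
    · exact ((hsep i j (Ne.symm hij)).eventually_ge_atTop _).mono fun t ht _ ↦ ht
  filter_upwards [eventually_all.2 E1] with t ht x hx0 hxR j hji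
  obtain ⟨hxc0, hxcn⟩ := sub_ofTimeSpace_apply_zero hx0 (ξ j t)
  have htri : ‖ξ i t - ξ j t‖ ≤ ‖E4.spatial x - ξ i t‖ + ‖E4.spatial x - ξ j t‖ := by
    calc ‖ξ i t - ξ j t‖ = ‖(E4.spatial x - ξ j t) - (E4.spatial x - ξ i t)‖ := by congr 1; abel
      _ ≤ _ := norm_sub_le _ _
      _ = _ := add_comm _ _
  have hfarj := ht j hji
  have hdist : (max 1 (2 * |a j|) + |a j|) + (C j / δ + 1) ≤ ‖x - E4.ofTimeSpace t (ξ j t)‖ := by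
    rw [hxcn]; linarith
  have hCδ : 0 ≤ C j / δ + 1 := by have := hC0 j; positivity
  have hfar : max 1 (2 * |a j|) + |a j| ≤ ‖x - E4.ofTimeSpace t (ξ j t)‖ := by linarith
  have hm1 : (1 : ℝ) ≤ max 1 (2 * |a j|) := le_max_left _ _
  have hd0 : 0 < ‖x - E4.ofTimeSpace t (ξ j t)‖ := by linarith [abs_nonneg (a j)]
  set d : ℝ := ‖x - E4.ofTimeSpace t (ξ j t)‖ with hd
  -- skewness of the body rate
  have hSd : HasDerivAt (fun s ↦ (((Λ j s : E4 ≃L[ℝ] E4).symm : E4 →L[ℝ] E4)))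
      (deriv (fun s ↦ (((Λ j s : E4 ≃L[ℝ] E4).symm : E4 →L[ℝ] E4))) t) t :=
    ((contDiff_lorentz_symm (hsm j).2).differentiable (by simp) t).hasDerivAt
  have hA : ∀ u w : E4, Minkowski.bilin (((deriv (fun s ↦ (((Λ j s : E4 ≃L[ℝ] E4).symm : E4 →L[ℝ] E4))) t).comp ((Λ j t : E4 ≃L[ℝ] E4) : E4 →L[ℝ] E4)) u) w + Minkowski.bilin u (((deriv (fun s ↦ (((Λ j s : E4 ≃L[ℝ] E4).symm : E4 →L[ℝ] E4))) t).comp ((Λ j t : E4 ≃L[ℝ] E4) : E4 →L[ℝ] E4)) w) = 0 :=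
    fun u w ↦ minkowski_skew_of_hasDerivAt_lorentz_symm hSd u w
  refine (hCfar j (Λ j t) _ _ (E4.ofTimeSpace t (ξ j t)) x (hγ j t) hA hxc0 hfar).trans ?_
  rw [div_le_iff₀ hd0]
  have hred : 0 ≤ (‖((deriv (fun s ↦ (((Λ j s : E4 ≃L[ℝ] E4).symm : E4 →L[ℝ] E4))) t).comp ((Λ j t : E4 ≃L[ℝ] E4) : E4 →L[ℝ] E4)) (E4.basisVector 0)‖ + ‖E4.spatial (-((((Λ j t : E4 ≃L[ℝ] E4).symm : E4 →L[ℝ] E4)) (deriv (fun s ↦ E4.ofTimeSpace s (ξ j s)) t)))‖ + ‖(a j) • ((deriv (fun s ↦ (((Λ j s : E4 ≃L[ℝ] E4).symm : E4 →L[ℝ] E4))) t).comp ((Λ j t : E4 ≃L[ℝ] E4) : E4 →L[ℝ] E4)) (E4.basisVector 3)‖) := by positivity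
  have h4 : C j ≤ δ * d := by
    have := (div_le_iff₀ hδ).1 (by linarith [abs_nonneg (a j)] : C j / δ ≤ d)
    linarith [mul_comm d δ]
  calc C j * (‖((deriv (fun s ↦ (((Λ j s : E4 ≃L[ℝ] E4).symm : E4 →L[ℝ] E4))) t).comp ((Λ j t : E4 ≃L[ℝ] E4) : E4 →L[ℝ] E4)) (E4.basisVector 0)‖ + ‖E4.spatial (-((((Λ j t : E4 ≃L[ℝ] E4).symm : E4 →L[ℝ] E4)) (deriv (fun s ↦ E4.ofTimeSpace s (ξ j s)) t)))‖ + ‖(a j) • ((deriv (fun s ↦ (((Λ j s : E4 ≃L[ℝ] E4).symm : E4 →L[ℝ] E4))) t).comp ((Λ j t : E4 ≃L[ℝ] E4) : E4 →L[ℝ] E4)) (E4.basisVector 3)‖)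
      ≤ (δ * d) * (‖((deriv (fun s ↦ (((Λ j s : E4 ≃L[ℝ] E4).symm : E4 →L[ℝ] E4))) t).comp ((Λ j t : E4 ≃L[ℝ] E4) : E4 →L[ℝ] E4)) (E4.basisVector 0)‖ + ‖E4.spatial (-((((Λ j t : E4 ≃L[ℝ] E4).symm : E4 →L[ℝ] E4)) (deriv (fun s ↦ E4.ofTimeSpace s (ξ j s)) t)))‖ + ‖(a j) • ((deriv (fun s ↦ (((Λ j s : E4 ≃L[ℝ] E4).symm : E4 →L[ℝ] E4))) t).comp ((Λ j t : E4 ≃L[ℝ] E4) : E4 →L[ℝ] E4)) (E4.basisVector 3)‖) := mul_le_mul_of_nonneg_right h4 hred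
    _ = _ := by ring

end Frozen

/-- **Registered one-line carrier form** (`firstOrder_isMetricOn_D8`, stub (D) of the crux item)
of `firstOrder_isMetricOn_of`. [cite: ONeill1983, Ch. 3, Def. 3.1] -/
theorem firstOrder_isMetricOn_D8 : open Literature.Geometry.Lorentzian in ∀ {G : E4 → E4 →L[ℝ] E4 →L[ℝ] ℝ} {U : Set E4}, IsOpen U → (∀ z ∈ U, ContDiffAt ℝ ((⊤ : ℕ∞) : WithTop ℕ∞) G z) → (∀ z v w : E4, G z v w = G z w v) → MetricCoord.IsMetricOn G (U ∩ {z | (G z).IsInvertible}) :=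
  fun hU hG hs ↦ firstOrder_isMetricOn_of hU hG hs

end Summit.FinalStateConjecture.FinalStateConjecture.Theorems.SublinearIsFree.Slaving

end
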